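import Summits.AtomisticToContinuum.Crystallization.Theorems.ChartedZeroExcessLayeredLatticeLiouvilleYJB

/-!
# Charted zero-excess layered-lattice Liouville — YJ-C «SecantLadder»: the typed ladder beneath (QC) and the PROVED door-set tail moment (lens-2 g66)

Part 3 of 4 of node g66 «SecantLadder + NearFarShellSplit» (docket `stmt-AtomisticToContinuum-26636`; CRITIC-LEDGER row 1194 (b‴)(c‴)).  Imports part YJ-B only —
every statement here is over TREE vocabulary (`IsDoorSetP`, `IsEquilChart`, `LayeredHom`, `coreOf`, `IsTameOn`, `IsTameStar`, `clampedEnergy`), so this part can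
land at any time after YJ-A/YJ-B, ahead of the YF → YI queue, and its one UNDECIDED statement is addressable by certificate seats at once.

* **YJ-5 THE TYPED SECANT LADDER** (statements with the binders of part YI's (QC) `MildClampedConvexityP` VERBATIM — criticality of the filling included, it is
  essential): (QS) `MildSecantFloorP … κ …` (second differences of the clamped energy along the matched segment `τ ↦ y + τ·(xf − y)` are
  `≥ (κ/2)·t²·Σᵢ dist(xf i, y i)²`, `t ∈ (0,1]`); (QSⁿ) `NearSecantFloorP … R cN …` (the same for the NEAR part: the family's own interaction + pair sums against
  the frozen atoms inside `B̄(x₀, R)` — FINITELY many positions, the SPECIAL class; THE HEART, UNDECIDED, CERT-able, instrument «MildBorn»); its certificate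
  form (QH) `NearHessianFloorP` (`C²` along the segment with `g″ ≥ 2cN·Σ dist²`); (QSᶠ) `FarSecantDriftP … R cF …` (the FAR part's second differences are
  `≤ cF·t²·Σ dist²` in size — the GENERIC class); (TM) `DoorTailMomentP aHi R Rc T` (the far shell's inverse-eighth moment on door sets is `≤ T`).
  PROVED: `(QSⁿ)(cN) ∧ (QSᶠ)(cF) ∧ κ + 2cF ≤ cN ⇒ (QS)(κ)` (`mildSecantFloorP_of_near_far`, the shell split of part YJ-B); `(QH) ⇒ (QSⁿ)`
  (`nearSecantFloorP_of_hessianFloor`); `(TM)(T) ⇒ (QSᶠ)(12·T)` for `q + ρ + dm ≤ Rc`, `Rc + 1 ≤ R` (`farSecantDriftP_of_doorTailMoment`, part YJ-B's far-field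
  bound); the dials `.of_le`.  `(QS) ⇒ (QC)` is part YJ (it needs part YI's (QC)).
* **YJ-7 THE DOOR-SET TAIL MOMENT, PROVED**: an `r`-separated set meets `B̄(x₀, ρ')` in `≤ (2ρ'/r + 1)³` points (`card_le_of_separated_of_dist_le`); grouping the far
  shell by integer distances and telescoping `Σ_k (m + k)⁻⁵ ≤ (m − 1)⁻⁴/4` gives `tailMoment_le_of_isSep` (summable, explicit bound); door sets at ceiling `1` are
  `27/32`-separated (part TF `isSep_of_isClean`), whence `doorTailMomentP_one` and the record `doorTailMomentP_record : DoorTailMomentP 1 41 (41/2) (1/4000)`.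
  With it the generic side of the node's dichotomy is a THEOREM; the only statement of the ladder left UNDECIDED is the finite-dimensional (QSⁿ) (with (QH)).
-/

noncomputable section

open scoped BigOperators Classical
open Set Metric Filter Topology
open Summit.AtomisticToContinuum.Crystallization.Theorems.ChartedPlanarOrderRigidityDoor (E3)
open Summit.AtomisticToContinuum.Crystallization.Theorems.ChartedPlanarOrderDensityDichotomy (μS IsSep)
open Summit.AtomisticToContinuum.Crystallization.Theorems.ChartedPlanarOrderCleanScaleP (IsCleanP IsDoorSetP)
open Summit.AtomisticToContinuum.Crystallization.Theorems.ChartedPlanarOrderMesoCut (LayeredHom)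
open Summit.AtomisticToContinuum.Crystallization.Theorems.ChartedPlanarOrderDoorLayeredOsc (IsTwoShellAffineGood)
open Literature.MathematicalPhysics.StatisticalMechanics (card_le_of_separated_of_dist_le lennardJones interactionEnergy)

namespace Summit.AtomisticToContinuum.Crystallization.Theorems.ChartedZeroExcessLayeredLatticeLiouville

/-! ### YJ-5  THE TYPED SECANT LADDER beneath (QC): (QS) `MildSecantFloorP` ⟸ (QSⁿ) `NearSecantFloorP` ∧ (QSᶠ) `FarSecantDriftP` (∧ `κ + 2cF ≤ cN`) (PROVED);
(QSᶠ)(12·T) ⟸ (TM) `DoorTailMomentP` (PROVED); (QSⁿ)(cN) ⟸ (QH) `NearHessianFloorP`(cN) (PROVED); (TM) itself PROVED at ceiling `1` (YJ-7); `(QS) ⇒ (QC)` is part YJ -/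

/-- ★★★ **(QS) «MildSecantFloorP ϑ ϑp q ρ rm dm κ aHi Λ θ s» — THE SECANT (SECOND-DIFFERENCE) FLOOR ALONG MATCHED SEGMENTS.**  The binders of (QC)
`MildClampedConvexityP` VERBATIM (door set, summable pair sums, θ-goodness, equilibrium chart, centre, container with `ϑp`-tame `rm`-core, injective enumeration
`xf` of the `ρ`-core, filling `y` matched within `dm`, injective, off the exterior, CLAMPED-CRITICAL, `ϑ`-tame sitewise); conclusion: for every dyadic-or-not
step `t ∈ (0, 1]` the second difference of the clamped energy along the matched segment `segConf y xf` (`τ ↦ y + τ·(xf − y)`) at base `y` is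
`≥ (κ/2)·t²·Σᵢ dist(xf i, y i)²`.  A DISCRETE CONVEXITY statement: no derivative of the clamped energy beyond the criticality ALREADY among (QC)'s binders is
mentioned.  `(QS)(κ) ⇒ (QC)(κ)` PROVED (part YJ `mildClampedConvexityP_of_secantFloor`, via the dyadic secant lemma YJ-1).  UNDECIDED · LEVEL-FREE in the moat temperature ·
the SAME Born-type bet as (QC) (it is (QC) localised to second differences) · CERT-able · INSTRUMENTABLE («MildBorn» read as second differences along the sampled
matched segments at `t ∈ {1, ½, ¼, …}`).  SIDEWAYS w.r.t. [MCMCᶜ]; implies (QC), not conversely (a secant floor at every scale is more than the endpoint inequality).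
Why it might fail: exactly (QC)'s risk, now scale by scale — a matched segment in the mild class along which some second difference of the clamped energy is
`< (κ/2)t²Σdist²` (a collectively soft clamped mode at `≤ 2.5 %` strain); the criticality binder is essential (without it near-registry-slipped admissible `y` would
make straight segments cross energy mountains — pre-registered, g66 NOTES).
Sources: part YI ((QC), row 1194 (b‴)); Bétermin, SIAM J. Math. Anal. 48 (2016) 3236 [arXiv:1505.08047, Def. 2.4/Thm 3.2: N-compact local minimality of
Lennard-Jones lattices = positivity of finite-dimensional second variations]; Hudson–Ortner, ESAIM:M2AN 46 (2012) 81 (stability of LJ crystals under finite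
deformation); Wallace, Thermodynamics of Crystals (1972) (Born criteria). [this file, g66] -/
def MildSecantFloorP (ϑ ϑp q ρ rm dm κ aHi Λ θ s : ℝ) : Prop :=
  ∀ δ : ℝ, 0 < δ → ∀ a : ℝ, 0 < a →
    ∀ S : Set E3, IsDoorSetP aHi δ S → (∀ z : E3, Summable fun y : S => lennardJones (dist z (y : E3))) →
      (∀ p ∈ S, IsTwoShellAffineGood θ S p) →
        ∀ (L : E3 ≃L[ℝ] E3) (w : ℤ → E3), IsEquilChart a s Λ L w →
          ∀ (x₀ : E3) (K : Set E3), K ⊆ S → (∀ k ∈ K, dist k x₀ ≤ q) →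
            IsTameOn ϑp S (LayeredHom (L : E3 →L[ℝ] E3) w) (coreOf S K rm) →
              ∀ (n : ℕ) (xf : Fin n → E3), Function.Injective xf → Set.range xf = coreOf S K ρ →
                ∀ y : Fin n → E3, (∀ i, dist (xf i) (y i) ≤ dm) → Function.Injective y → Disjoint (Set.range y) (S \ coreOf S K ρ) →
                  HasFDerivAt (fun z : Fin n → E3 => clampedEnergy (S \ coreOf S K ρ) z) (0 : (Fin n → E3) →L[ℝ] ℝ) y →
                    (∀ i, IsTameStar ϑ ((S \ coreOf S K ρ) ∪ Set.range y) (LayeredHom (L : E3 →L[ℝ] E3) w) (y i)) →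
                      ∀ t : ℝ, 0 < t → t ≤ 1 →
                        κ / 2 * t ^ 2 * ∑ i, dist (xf i) (y i) ^ 2 ≤ secondDiff (fun τ => clampedEnergy (S \ coreOf S K ρ) (segConf y xf τ)) t

/-- **(QS) WEAKENS as `κ` decreases (PROVED).** [this file, g66] -/
theorem MildSecantFloorP.of_le {ϑ ϑp q ρ rm dm κ κ' aHi Λ θ s : ℝ} (hle : κ' ≤ κ) (h : MildSecantFloorP ϑ ϑp q ρ rm dm κ aHi Λ θ s) :
    MildSecantFloorP ϑ ϑp q ρ rm dm κ' aHi Λ θ s := by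
  intro δ hδ a ha S hS hsum hgood L w hLw x₀ K hKS hKq hmild n xf hxf hrange y hnear hyinj hydisj hcrit htame t ht ht1
  have key := h δ hδ a ha S hS hsum hgood L w hLw x₀ K hKS hKq hmild n xf hxf hrange y hnear hyinj hydisj hcrit htame t ht ht1
  have hs : 0 ≤ t ^ 2 * ∑ i, dist (xf i) (y i) ^ 2 := mul_nonneg (by positivity) (Finset.sum_nonneg fun i _ => by positivity)
  nlinarith

/-- ★★★ **(QSⁿ) «NearSecantFloorP ϑ ϑp q ρ rm dm R cN aHi Λ θ s» — THE NEAR-FIELD SECANT FLOOR (the HEART; special class).**  The binders of (QC) VERBATIM;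
conclusion: for `t ∈ (0,1]` the second difference along the matched segment of the NEAR part `nearClampedEnergy (S ∖ core) x₀ R` — the family's own
interaction energy plus its pair sums against the frozen atoms INSIDE `B̄(x₀, R)`, a functional of FINITELY many atom positions (the `ρ`-core moves, the frozen
annulus `core ⊂ B̄(x₀, R)` is finite by separation) — is `≥ (cN/2)·t²·Σᵢ dist(xf i, y i)²`.  FINITE-DIMENSIONAL · LOCAL · UNDECIDED · CERT-able (a certified
floor `2cN` on the smallest eigenvalue of the near Hessian over the matched segments gives it: (QH) ⇒ (QSⁿ) PROVED, `nearSecantFloorP_of_hessianFloor`) ·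
INSTRUMENTABLE («MildBorn(1/10)» of CRITIC-LEDGER row 1194 (c‴)(1), near part) · the special class of the structural dichotomy: the finitely many strained stars.
Why it might fail: (QC)'s Born bet — a mild (`ϑp = 1/10`, bond strains `≲ 2.5 %`) clamped core whose near Hessian along a matched segment has an eigenvalue
`< 2cN` with `cN ≤ 24·T` (single-bond `V″` spreads `−42 %/+66 %` at `2.5 %` strain, row 1194; the bet is collective clamped stiffness); repair = the amplitude dial
`ϑp ↓` of part YG at the price of [WHSᵇ](ϑp) ↑.
Sources: part YI ((QC)); CRITIC-LEDGER row 1194 (b‴)(c‴); Bétermin arXiv:1505.08047 Thm 3.2; Hudson–Ortner ESAIM:M2AN 46 (2012) 81; E–Ming, Arch. Ration.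
Mech. Anal. 183 (2007) 241 §2 (Born/Cauchy–Born stability conditions). [this file, g66] -/
def NearSecantFloorP (ϑ ϑp q ρ rm dm R cN aHi Λ θ s : ℝ) : Prop :=
  ∀ δ : ℝ, 0 < δ → ∀ a : ℝ, 0 < a →
    ∀ S : Set E3, IsDoorSetP aHi δ S → (∀ z : E3, Summable fun y : S => lennardJones (dist z (y : E3))) →
      (∀ p ∈ S, IsTwoShellAffineGood θ S p) →
        ∀ (L : E3 ≃L[ℝ] E3) (w : ℤ → E3), IsEquilChart a s Λ L w →
          ∀ (x₀ : E3) (K : Set E3), K ⊆ S → (∀ k ∈ K, dist k x₀ ≤ q) →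
            IsTameOn ϑp S (LayeredHom (L : E3 →L[ℝ] E3) w) (coreOf S K rm) →
              ∀ (n : ℕ) (xf : Fin n → E3), Function.Injective xf → Set.range xf = coreOf S K ρ →
                ∀ y : Fin n → E3, (∀ i, dist (xf i) (y i) ≤ dm) → Function.Injective y → Disjoint (Set.range y) (S \ coreOf S K ρ) →
                  HasFDerivAt (fun z : Fin n → E3 => clampedEnergy (S \ coreOf S K ρ) z) (0 : (Fin n → E3) →L[ℝ] ℝ) y →
                    (∀ i, IsTameStar ϑ ((S \ coreOf S K ρ) ∪ Set.range y) (LayeredHom (L : E3 →L[ℝ] E3) w) (y i)) →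
                      ∀ t : ℝ, 0 < t → t ≤ 1 →
                        cN / 2 * t ^ 2 * ∑ i, dist (xf i) (y i) ^ 2 ≤
                          secondDiff (fun τ => nearClampedEnergy (S \ coreOf S K ρ) x₀ R (segConf y xf τ)) t

/-- **(QSⁿ) WEAKENS as `cN` decreases (PROVED).** [this file, g66] -/
theorem NearSecantFloorP.of_le {ϑ ϑp q ρ rm dm R cN cN' aHi Λ θ s : ℝ} (hle : cN' ≤ cN) (h : NearSecantFloorP ϑ ϑp q ρ rm dm R cN aHi Λ θ s) :
    NearSecantFloorP ϑ ϑp q ρ rm dm R cN' aHi Λ θ s := by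
  intro δ hδ a ha S hS hsum hgood L w hLw x₀ K hKS hKq hmild n xf hxf hrange y hnear hyinj hydisj hcrit htame t ht ht1
  have key := h δ hδ a ha S hS hsum hgood L w hLw x₀ K hKS hKq hmild n xf hxf hrange y hnear hyinj hydisj hcrit htame t ht ht1
  have hs : 0 ≤ t ^ 2 * ∑ i, dist (xf i) (y i) ^ 2 := mul_nonneg (by positivity) (Finset.sum_nonneg fun i _ => by positivity)
  nlinarith

/-- ★★ **(QH) «NearHessianFloorP ϑ ϑp q ρ rm dm R cN aHi Λ θ s» — THE NEAR-FIELD HESSIAN FLOOR (the CERTIFICATE's native form).**  The binders of (QC) VERBATIM;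
conclusion: along the matched segment the near energy `g(τ) = nearClampedEnergy (S ∖ core) x₀ R (segConf y xf τ)` is twice differentiable on `[0,1]` with
`g″ ≥ 2cN·Σᵢ dist(xf i, y i)²` — i.e. the near Hessian satisfies `D²[d, d] ≥ 2cN‖d‖²` in the segment direction `d = xf − y` at every point of the segment (what a
certified smallest-eigenvalue floor of the near Hessian over the mild⁺ class delivers).  `(QH)(cN) ⇒ (QSⁿ)(cN)` PROVED (`nearSecantFloorP_of_hessianFloor`, YJ-4's
`le_secondDiff_of_deriv2_floor`).  STRONGER than (QSⁿ); typed so that a stiffness CERT has a home.  Tags and risk: as (QSⁿ).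
Sources: as (QSⁿ). [this file, g66] -/
def NearHessianFloorP (ϑ ϑp q ρ rm dm R cN aHi Λ θ s : ℝ) : Prop :=
  ∀ δ : ℝ, 0 < δ → ∀ a : ℝ, 0 < a →
    ∀ S : Set E3, IsDoorSetP aHi δ S → (∀ z : E3, Summable fun y : S => lennardJones (dist z (y : E3))) →
      (∀ p ∈ S, IsTwoShellAffineGood θ S p) →
        ∀ (L : E3 ≃L[ℝ] E3) (w : ℤ → E3), IsEquilChart a s Λ L w →
          ∀ (x₀ : E3) (K : Set E3), K ⊆ S → (∀ k ∈ K, dist k x₀ ≤ q) →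
            IsTameOn ϑp S (LayeredHom (L : E3 →L[ℝ] E3) w) (coreOf S K rm) →
              ∀ (n : ℕ) (xf : Fin n → E3), Function.Injective xf → Set.range xf = coreOf S K ρ →
                ∀ y : Fin n → E3, (∀ i, dist (xf i) (y i) ≤ dm) → Function.Injective y → Disjoint (Set.range y) (S \ coreOf S K ρ) →
                  HasFDerivAt (fun z : Fin n → E3 => clampedEnergy (S \ coreOf S K ρ) z) (0 : (Fin n → E3) →L[ℝ] ℝ) y →
                    (∀ i, IsTameStar ϑ ((S \ coreOf S K ρ) ∪ Set.range y) (LayeredHom (L : E3 →L[ℝ] E3) w) (y i)) →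
                      ∃ g₁ g₂ : ℝ → ℝ,
                        (∀ τ : ℝ, 0 ≤ τ → τ ≤ 1 → HasDerivAt (fun τ' => nearClampedEnergy (S \ coreOf S K ρ) x₀ R (segConf y xf τ')) (g₁ τ) τ) ∧
                          (∀ τ : ℝ, 0 ≤ τ → τ ≤ 1 → HasDerivAt g₁ (g₂ τ) τ) ∧
                            ∀ τ : ℝ, 0 ≤ τ → τ ≤ 1 → 2 * cN * ∑ i, dist (xf i) (y i) ^ 2 ≤ g₂ τ

/-- ★★ **(QH)(cN) ⇒ (QSⁿ)(cN) (PROVED)** — Hessian floor ⇒ secant floor, YJ-4. [this file, g66] -/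
theorem nearSecantFloorP_of_hessianFloor {ϑ ϑp q ρ rm dm R cN aHi Λ θ s : ℝ} (h : NearHessianFloorP ϑ ϑp q ρ rm dm R cN aHi Λ θ s) :
    NearSecantFloorP ϑ ϑp q ρ rm dm R cN aHi Λ θ s := by
  intro δ hδ a ha S hS hsum hgood L w hLw x₀ K hKS hKq hmild n xf hxf hrange y hnear hyinj hydisj hcrit htame t ht ht1
  obtain ⟨g₁, g₂, hg, hg', hm⟩ := h δ hδ a ha S hS hsum hgood L w hLw x₀ K hKS hKq hmild n xf hxf hrange y hnear hyinj hydisj hcrit htame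
  have key := le_secondDiff_of_deriv2_floor hg hg' hm ht ht1
  have e : 2 * cN * (∑ i, dist (xf i) (y i) ^ 2) * t ^ 2 / 4 = cN / 2 * t ^ 2 * ∑ i, dist (xf i) (y i) ^ 2 := by ring
  linarith

/-- ★★ **(QSᶠ) «FarSecantDriftP q ρ dm R cF aHi» — THE FAR-FIELD SECANT DRIFT (generic class; PROVED from (TM)).**  For every `aHi`-door set `S` with summable pair
sums, centre `x₀`, container `K ⊆ S ∩ B̄(x₀, q)`, enumeration `xf` of the `ρ`-core and filling `y` matched within `dm` (NO criticality, NO tameness, NO chart needed):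
the second differences along the matched segment of the FAR part `farClampedEnergy (S ∖ core) x₀ R` (pair sums against the frozen atoms OUTSIDE `B̄(x₀, R)`) are
`≤ cF·t²·Σᵢ dist(xf i, y i)²` in absolute value.  KNOWN-MATH · PROVED here from the tail moment (TM) with `cF = 12·T` (`farSecantDriftP_of_doorTailMoment`: every
far bond stays `≥ dist(p, x₀) − (q + ρ + dm) ≥ 1` long along the segment, the one-bond estimate YJ-2 and termwise summation YJ-3).
Sources: this file (PROVED). [this file, g66] -/
def FarSecantDriftP (q ρ dm R cF aHi : ℝ) : Prop :=
  ∀ δ : ℝ, 0 < δ → ∀ S : Set E3, IsDoorSetP aHi δ S → (∀ z : E3, Summable fun y : S => lennardJones (dist z (y : E3))) →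
    ∀ (x₀ : E3) (K : Set E3), K ⊆ S → (∀ k ∈ K, dist k x₀ ≤ q) →
      ∀ (n : ℕ) (xf : Fin n → E3), Set.range xf = coreOf S K ρ → ∀ y : Fin n → E3, (∀ i, dist (xf i) (y i) ≤ dm) →
        ∀ t : ℝ, 0 < t → t ≤ 1 →
          |secondDiff (fun τ => farClampedEnergy (S \ coreOf S K ρ) x₀ R (segConf y xf τ)) t| ≤ cF * t ^ 2 * ∑ i, dist (xf i) (y i) ^ 2

/-- ★★★ **THE NEAR/FAR GLUE (PROVED): (QSⁿ)(cN) ∧ (QSᶠ)(cF) ∧ `κ + 2·cF ≤ cN` ⇒ (QS)(κ).**  Split `clampedEnergy = near + far` along the segment (YJ-3), add the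
near floor and the far drift. [this file, g66] -/
theorem mildSecantFloorP_of_near_far {ϑ ϑp q ρ rm dm R cN cF κ aHi Λ θ s : ℝ} (hκ : κ + 2 * cF ≤ cN)
    (hN : NearSecantFloorP ϑ ϑp q ρ rm dm R cN aHi Λ θ s) (hF : FarSecantDriftP q ρ dm R cF aHi) :
    MildSecantFloorP ϑ ϑp q ρ rm dm κ aHi Λ θ s := by
  intro δ hδ a ha S hS hsum hgood L w hLw x₀ K hKS hKq hmild n xf hxf hrange y hnear hyinj hydisj hcrit htame t ht ht1
  have h1 := hN δ hδ a ha S hS hsum hgood L w hLw x₀ K hKS hKq hmild n xf hxf hrange y hnear hyinj hydisj hcrit htame t ht ht1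
  have h2 := hF δ hδ S hS hsum x₀ K hKS hKq n xf hrange y hnear t ht ht1
  set X : Set E3 := S \ coreOf S K ρ with hX
  have hXS : X ⊆ S := fun p hp => hp.1
  have hsplit : (fun τ => clampedEnergy X (segConf y xf τ))
      = fun τ => nearClampedEnergy X x₀ R (segConf y xf τ) + farClampedEnergy X x₀ R (segConf y xf τ) := by
    funext τ
    exact clampedEnergy_eq_near_add_far X x₀ R (segConf y xf τ)
      (fun i => summable_coe_subset hXS (f := fun p => lennardJones (dist (segConf y xf τ i) p)) (hsum _))
  rw [hsplit, secondDiff_add]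
  have h2' := (abs_le.1 h2).1
  have hs : 0 ≤ t ^ 2 * ∑ i, dist (xf i) (y i) ^ 2 := mul_nonneg (by positivity) (Finset.sum_nonneg fun i _ => by positivity)
  nlinarith

/-- ★★ **(TM) «DoorTailMomentP aHi R Rc T» — THE DOOR-SET TAIL MOMENT (generic class; PROVED at the record ceiling, YJ-7).**  For every `aHi`-door set `S` (any
separation `δ > 0`), every `X ⊆ S` and every centre `x₀`: the inverse-eighth moment of the far shell, `Σ'_{p ∈ X ∖ B̄(x₀, R)} (dist(p, x₀) − Rc)⁻⁸`, is summable
and `≤ T`.  At ceiling `aHi = 1` cleanliness forces the UNIFORM separation `27/32` whatever `δ` is (part TF `isSep_of_isClean`), so `#(X ∩ B̄(x₀, D)) ≤ (64D/27 + 1)³`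
and the shell sum converges (`8 > 3 + 1`): `doorTailMomentP_one` PROVES (TM)(1, R, Rc, T) for `0 ≤ Rc`, `Rc + 2 ≤ R` and an explicit `T` (shell counting by
`card_le_of_separated_of_dist_le`, telescoping `Σ_k (R − Rc + k)⁻⁵ ≤ (R − Rc − 1)⁻⁴/4`); the record instance `DoorTailMomentP 1 41 (41/2) (1/4000)` is
`doorTailMomentP_record`.  Kept as a NAMED statement so that other ceilings / geometries stay dialable (`DoorTailMomentP.of_le`).
Sources: `Literature.MathematicalPhysics.StatisticalMechanics.card_le_of_separated_of_dist_le`; part TF `isSep_of_isClean`; Blanc–Lewin, EMS Surv. Math. Sci. 2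
(2015) 255 §2 (lattice sums). [this file, g66] -/
def DoorTailMomentP (aHi R Rc T : ℝ) : Prop :=
  ∀ δ : ℝ, 0 < δ → ∀ S : Set E3, IsDoorSetP aHi δ S → ∀ X : Set E3, X ⊆ S → ∀ x₀ : E3,
    Summable (fun p : ↥(X \ closedBall x₀ R) => ((dist (p : E3) x₀ - Rc) ^ 8)⁻¹) ∧
      ∑' p : ↥(X \ closedBall x₀ R), ((dist (p : E3) x₀ - Rc) ^ 8)⁻¹ ≤ T

/-- **(TM) WEAKENS as `T` increases (PROVED).** [this file, g66] -/
theorem DoorTailMomentP.of_le {aHi R Rc T T' : ℝ} (hle : T ≤ T') (h : DoorTailMomentP aHi R Rc T) : DoorTailMomentP aHi R Rc T' :=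
  fun δ hδ S hS X hXS x₀ => ⟨(h δ hδ S hS X hXS x₀).1, (h δ hδ S hS X hXS x₀).2.trans hle⟩

/-- ★★★ **(TM)(T) ⇒ (QSᶠ)(cF = 12·T) (PROVED)** for `q + ρ + dm ≤ Rc`, `0 ≤ dm`, `Rc + 1 ≤ R`: both endpoints of every matched pair lie in `B̄(x₀, Rc)` (the
enumeration ranges in the `ρ`-core of a container within `q` of `x₀`; the filling is matched within `dm`), so YJ-3's far-field bound applies. [this file, g66] -/
theorem farSecantDriftP_of_doorTailMoment {q ρ dm R Rc T aHi : ℝ} (hRc : q + ρ + dm ≤ Rc) (hdm : 0 ≤ dm) (hR : Rc + 1 ≤ R)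
    (h : DoorTailMomentP aHi R Rc T) : FarSecantDriftP q ρ dm R (12 * T) aHi := by
  intro δ hδ S hS hsum x₀ K hKS hKq n xf hrange y hnear t ht ht1
  have hXS : S \ coreOf S K ρ ⊆ S := fun p hp => hp.1
  obtain ⟨hTs, hT⟩ := h δ hδ S hS (S \ coreOf S K ρ) hXS x₀
  have hxf : ∀ i, dist (xf i) x₀ ≤ Rc := by
    intro i
    have hi : xf i ∈ coreOf S K ρ := hrange ▸ Set.mem_range_self i
    obtain ⟨_, k, hk, hik⟩ := hi
    linarith [dist_triangle (xf i) k x₀, hKq k hk]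
  have hy : ∀ i, dist (y i) x₀ ≤ Rc := by
    intro i
    have hi : xf i ∈ coreOf S K ρ := hrange ▸ Set.mem_range_self i
    obtain ⟨_, k, hk, hik⟩ := hi
    linarith [dist_triangle (y i) (xf i) x₀, dist_triangle (xf i) k x₀, hKq k hk, hnear i, dist_comm (xf i) (y i)]
  have key := abs_secondDiff_farClampedEnergy_le hXS x₀ hR hsum hTs hT hy hxf ht ht1
  linarith


/-! ### YJ-7  The far-shell tail moment of a separated set (PROVED) -/

/-- telescoping majorant of the inverse fifth power: `a⁻⁵ ≤ ((a−1)⁻⁴ − a⁻⁴)/4` for `a ≥ 2`. [this file, g66] -/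
theorem inv_pow_five_le_sub_div_four {a : ℝ} (ha : 2 ≤ a) :
    (a ^ 5)⁻¹ ≤ (((a - 1) ^ 4)⁻¹ - (a ^ 4)⁻¹) / 4 := by
  have ha0 : 0 < a := by linarith
  have hb : 0 < a - 1 := by linarith
  rw [← sub_nonneg]
  have h : (((a - 1) ^ 4)⁻¹ - (a ^ 4)⁻¹) / 4 - (a ^ 5)⁻¹
      = (10 * (a - 1) ^ 3 + 10 * (a - 1) ^ 2 + 5 * (a - 1) + 1) / (4 * a ^ 5 * (a - 1) ^ 4) := by
    field_simp
    ring
  rw [h]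
  positivity

/-- the partial sums `Σ_{k<M} (m + k)⁻⁵ ≤ (m − 1)⁻⁴/4` for `m ≥ 2` (telescoping). [this file, g66] -/
theorem sum_inv_pow_five_le {m : ℝ} (hm : 2 ≤ m) (M : ℕ) :
    ∑ k ∈ Finset.range M, ((m + k) ^ 5)⁻¹ ≤ ((m - 1) ^ 4)⁻¹ / 4 := by
  suffices h : ∑ k ∈ Finset.range M, ((m + k) ^ 5)⁻¹ ≤ ((m - 1) ^ 4)⁻¹ / 4 - ((m - 1 + M) ^ 4)⁻¹ / 4 by
    have : 0 ≤ ((m - 1 + M) ^ 4)⁻¹ / 4 := by positivity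
    linarith
  induction M with
  | zero => simp
  | succ M ih =>
    rw [Finset.sum_range_succ]
    have hM : (0 : ℝ) ≤ M := M.cast_nonneg
    have h1 := inv_pow_five_le_sub_div_four (a := m + M) (by linarith)
    have e1 : m - 1 + (M : ℝ) = m + M - 1 := by ring
    have e2 : m - 1 + ((M + 1 : ℕ) : ℝ) = m + M := by push_cast; ring
    rw [e2]
    rw [e1] at ih
    linarith

/-- separated points of a ball are few: an `r`-separated subset of `B̄(x₀, ρ')` in `ℝ³` has at most `(2ρ'/r + 1)³` points
(the Literature counting lemma `card_le_of_separated_of_dist_le` at `finrank = 3`). [this file, g66] -/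
theorem card_le_of_isSep_of_dist_le {r ρ' : ℝ} (hr : 0 < r) (hρ : 0 ≤ ρ') {X : Set E3} (hX : IsSep r X) (s : Finset E3)
    (x₀ : E3) (hs : ∀ p ∈ s, p ∈ X ∧ dist p x₀ ≤ ρ') : (s.card : ℝ) ≤ (2 * ρ' / r + 1) ^ 3 := by
  have h := card_le_of_separated_of_dist_le s x₀ hr hρ (fun c hc => (hs c hc).2)
    (fun c hc d hd hcd => hX c (hs c hc).1 d (hs d hd).1 hcd)
  rwa [finrank_euclideanSpace_fin] at h

/-- ★ the FINITE far-shell moment bound: for an `r`-separated `X ⊆ ℝ³`, a centre `x₀`, radii `0 ≤ Rc`, `Rc + 2 ≤ R` and a slope constant `c₀` with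
`2/r ≤ c₀` and `2(R+1)/r + 1 ≤ c₀·(R − Rc)`, every finite set `u` of points of `X` outside `B̄(x₀, R)` has
`Σ_{p ∈ u} (dist(p, x₀) − Rc)⁻⁸ ≤ c₀³/(4·(R − Rc − 1)⁴)` — group `u` by the integer shells `⌊dist(p,x₀) − R⌋ = k`, count each shell by
`card_le_of_isSep_of_dist_le` (`≤ (2(R+k+1)/r + 1)³ ≤ c₀³(R − Rc + k)³`), weigh it by `(R − Rc + k)⁻⁸`, and telescope `Σ_k (R − Rc + k)⁻⁵`. [this file, g66] -/
theorem sum_inv_pow_eight_le_of_isSep {r c₀ R Rc : ℝ} (hr : 0 < r) (hRc0 : 0 ≤ Rc) (hRc : Rc + 2 ≤ R) (hc₁ : 2 / r ≤ c₀)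
    (hc₂ : 2 * (R + 1) / r + 1 ≤ c₀ * (R - Rc)) {X : Set E3} (hX : IsSep r X) (x₀ : E3) (u : Finset E3)
    (hu : ∀ p ∈ u, p ∈ X ∧ R < dist p x₀) :
    ∑ p ∈ u, ((dist p x₀ - Rc) ^ 8)⁻¹ ≤ c₀ ^ 3 * (((R - Rc - 1) ^ 4)⁻¹ / 4) := by
  have hc0 : 0 ≤ c₀ := le_trans (by positivity) hc₁
  have hR0 : 0 ≤ R := by linarith
  have hm : 2 ≤ R - Rc := by linarith
  set g : E3 → ℕ := fun p => ⌊dist p x₀ - R⌋₊ with hg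
  have hmaps : ∀ p ∈ u, g p ∈ Finset.range (u.sup g + 1) := fun p hp =>
    Finset.mem_range.2 (Nat.lt_succ_of_le (Finset.le_sup hp))
  rw [← Finset.sum_fiberwise_of_maps_to hmaps]
  have hfib : ∀ k ∈ Finset.range (u.sup g + 1),
      ∑ p ∈ u.filter (fun p => g p = k), ((dist p x₀ - Rc) ^ 8)⁻¹ ≤ c₀ ^ 3 * ((R - Rc + k) ^ 5)⁻¹ := by
    intro k _
    have hk0 : (0 : ℝ) ≤ k := k.cast_nonneg
    have hmk : 0 < R - Rc + k := by linarith
    have hterm : ∀ p ∈ u.filter (fun p => g p = k), ((dist p x₀ - Rc) ^ 8)⁻¹ ≤ ((R - Rc + k) ^ 8)⁻¹ := by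
      intro p hp
      rw [Finset.mem_filter] at hp
      have hD : R < dist p x₀ := (hu p hp.1).2
      have hk : (k : ℝ) ≤ dist p x₀ - R := by
        rw [← hp.2]
        exact Nat.floor_le (by linarith)
      exact inv_anti₀ (by positivity) (pow_le_pow_left₀ hmk.le (by linarith) 8)
    have hcard : ((u.filter (fun p => g p = k)).card : ℝ) ≤ (2 * (R + k + 1) / r + 1) ^ 3 := by
      refine card_le_of_isSep_of_dist_le hr (by linarith) hX _ x₀ ?_
      intro p hp
      rw [Finset.mem_filter] at hp
      refine ⟨(hu p hp.1).1, ?_⟩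
      have h1 := Nat.lt_floor_add_one (dist p x₀ - R)
      have h2 : (⌊dist p x₀ - R⌋₊ : ℝ) = k := by rw [← hp.2]
      rw [h2] at h1
      linarith
    have hslope : 2 * (R + k + 1) / r + 1 ≤ c₀ * (R - Rc + k) := by
      have e : 2 * (R + k + 1) / r + 1 = (2 * (R + 1) / r + 1) + 2 / r * k := by ring
      rw [e]
      linarith [mul_le_mul_of_nonneg_right hc₁ hk0]
    calc ∑ p ∈ u.filter (fun p => g p = k), ((dist p x₀ - Rc) ^ 8)⁻¹
        ≤ ∑ p ∈ u.filter (fun p => g p = k), ((R - Rc + k) ^ 8)⁻¹ := Finset.sum_le_sum hterm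
      _ = (u.filter (fun p => g p = k)).card * ((R - Rc + k) ^ 8)⁻¹ := by rw [Finset.sum_const, nsmul_eq_mul]
      _ ≤ (2 * (R + k + 1) / r + 1) ^ 3 * ((R - Rc + k) ^ 8)⁻¹ := mul_le_mul_of_nonneg_right hcard (by positivity)
      _ ≤ (c₀ * (R - Rc + k)) ^ 3 * ((R - Rc + k) ^ 8)⁻¹ :=
          mul_le_mul_of_nonneg_right (pow_le_pow_left₀ (by positivity) hslope 3) (by positivity)
      _ = c₀ ^ 3 * ((R - Rc + k) ^ 5)⁻¹ := by
          field_simp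
  calc ∑ k ∈ Finset.range (u.sup g + 1), ∑ p ∈ u.filter (fun p => g p = k), ((dist p x₀ - Rc) ^ 8)⁻¹
      ≤ ∑ k ∈ Finset.range (u.sup g + 1), c₀ ^ 3 * ((R - Rc + k) ^ 5)⁻¹ := Finset.sum_le_sum hfib
    _ = c₀ ^ 3 * ∑ k ∈ Finset.range (u.sup g + 1), ((R - Rc + k) ^ 5)⁻¹ := by rw [Finset.mul_sum]
    _ ≤ c₀ ^ 3 * (((R - Rc - 1) ^ 4)⁻¹ / 4) := mul_le_mul_of_nonneg_left (sum_inv_pow_five_le hm _) (by positivity)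

/-- ★ the FAR-SHELL TAIL MOMENT of a separated set: under the hypotheses of `sum_inv_pow_eight_le_of_isSep` the family
`p ↦ (dist(p, x₀) − Rc)⁻⁸` on `X ∖ B̄(x₀, R)` is summable with sum `≤ c₀³/(4·(R − Rc − 1)⁴)` (bounded nonnegative partial sums). [this file, g66] -/
theorem tailMoment_le_of_isSep {r c₀ R Rc : ℝ} (hr : 0 < r) (hRc0 : 0 ≤ Rc) (hRc : Rc + 2 ≤ R) (hc₁ : 2 / r ≤ c₀)
    (hc₂ : 2 * (R + 1) / r + 1 ≤ c₀ * (R - Rc)) {X : Set E3} (hX : IsSep r X) (x₀ : E3) :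
    Summable (fun p : ↥(X \ closedBall x₀ R) => ((dist (p : E3) x₀ - Rc) ^ 8)⁻¹) ∧
      ∑' p : ↥(X \ closedBall x₀ R), ((dist (p : E3) x₀ - Rc) ^ 8)⁻¹ ≤ c₀ ^ 3 * (((R - Rc - 1) ^ 4)⁻¹ / 4) := by
  have hnn : ∀ p : ↥(X \ closedBall x₀ R), 0 ≤ ((dist (p : E3) x₀ - Rc) ^ 8)⁻¹ := fun p => by positivity
  have hfin : ∀ u : Finset ↥(X \ closedBall x₀ R),
      ∑ p ∈ u, ((dist (p : E3) x₀ - Rc) ^ 8)⁻¹ ≤ c₀ ^ 3 * (((R - Rc - 1) ^ 4)⁻¹ / 4) := by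
    intro u
    have h := sum_inv_pow_eight_le_of_isSep hr hRc0 hRc hc₁ hc₂ hX x₀ (u.map (Function.Embedding.subtype _)) ?_
    · rwa [Finset.sum_map] at h
    · intro p hp
      rw [Finset.mem_map] at hp
      obtain ⟨q, -, rfl⟩ := hp
      have hq : (q : E3) ∈ X \ closedBall x₀ R := q.2
      rw [Set.mem_sdiff, mem_closedBall, not_le] at hq
      exact hq
  exact ⟨summable_of_sum_le (fun p => hnn p) hfin, Real.tsum_le_of_sum_le (fun p => hnn p) hfin⟩

/-- door sets at ceiling `1` are `27/32`-separated (part TF `isSep_of_isClean`), and so is every subset. [this file, g66] -/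
theorem isSep_of_isDoorSetP_one {δ : ℝ} {S X : Set E3} (hS : IsDoorSetP 1 δ S) (hXS : X ⊆ S) : IsSep (27 / 32) X :=
  fun x hx y hy hxy => isSep_of_isClean hS.2.2.1 x (hXS hx) y (hXS hy) hxy

/-- ★★★ **(TM) AT CEILING `1` (PROVED)**: for `0 ≤ Rc`, `Rc + 2 ≤ R` and a slope constant `c₀ ≥ 64/27` with `64(R+1)/27 + 1 ≤ c₀·(R − Rc)`, every `T ≥ c₀³/(4(R − Rc − 1)⁴)`
has `DoorTailMomentP 1 R Rc T` — door sets are `27/32`-separated (`isSep_of_isDoorSetP_one`) and `tailMoment_le_of_isSep` applies to every `X ⊆ S`. [this file, g66] -/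
theorem doorTailMomentP_one {R Rc c₀ T : ℝ} (hRc0 : 0 ≤ Rc) (hRc : Rc + 2 ≤ R) (hc₁ : 64 / 27 ≤ c₀)
    (hc₂ : 64 * (R + 1) / 27 + 1 ≤ c₀ * (R - Rc)) (hT : c₀ ^ 3 * (((R - Rc - 1) ^ 4)⁻¹ / 4) ≤ T) :
    DoorTailMomentP 1 R Rc T := by
  intro δ hδ S hS X hXS x₀
  have hsep : IsSep (27 / 32) X := isSep_of_isDoorSetP_one hS hXS
  have hc₁' : 2 / (27 / 32 : ℝ) ≤ c₀ := by
    have e : (2 : ℝ) / (27 / 32) = 64 / 27 := by norm_num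
    rw [e]
    exact hc₁
  have hc₂' : 2 * (R + 1) / (27 / 32 : ℝ) + 1 ≤ c₀ * (R - Rc) := by
    have e : 2 * (R + 1) / (27 / 32 : ℝ) + 1 = 64 * (R + 1) / 27 + 1 := by ring
    rw [e]
    exact hc₂
  have h := tailMoment_le_of_isSep (by norm_num) hRc0 hRc hc₁' hc₂' hsep x₀
  exact ⟨h.1, h.2.trans hT⟩

/-- ★★★ **THE RECORD TAIL MOMENT (PROVED)**: `DoorTailMomentP 1 41 (41/2) (1/4000)` — the generic leaf of the secant docket at the record geometry
`(R, Rc) = (41, 41/2)`, with `c₀ = 5`: `5³/(4·(39/2)⁴) = 125/578360.25 ≤ 1/4000`.  Hence the far-field drift constant of the record ladder is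
`cF = 12·T = 3/1000` and the docket's side condition reads `cN > 24·T = 3/500`. [this file, g66] -/
theorem doorTailMomentP_record : DoorTailMomentP 1 41 (41 / 2) (1 / 4000) :=
  doorTailMomentP_one (c₀ := 5) (by norm_num) (by norm_num) (by norm_num) (by norm_num) (by norm_num)

end Summit.AtomisticToContinuum.Crystallization.Theorems.ChartedZeroExcessLayeredLatticeLiouville

end
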